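import Literature.Topology.FourManifolds.LatticeFormsTwoElementary
import Literature.AlgebraicGeometry.Surfaces.NikulinLatticeK3Embedding
import Literature.AlgebraicGeometry.Surfaces.K3NikulinInvolutionInvariantLattice
import Literature.AlgebraicGeometry.Surfaces.EnriquesInvolutionK3Lattice
import HarnessLib

/-!
# The K3-side even `2`-elementary lattices and their invariants `(r, a, δ)`: the Kummer lattice `K`, the Nikulin
# lattice `N`, `E₈(−2) = (Λ_{K3}^ι)^⊥` and `Λ_{K3}^ι ≅ U³ ⊕ E₈(−2)` of a Nikulin involution, and
# `Λ_{K3}^ι ≅ U(2) ⊕ E₈(−2)` of an Enriques involution (`(r, a, δ) = (10, 10, 0)`)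

Sequel, on the Surfaces side, of `Literature/Topology/FourManifolds/LatticeFormsTwoElementary.lean` (`IsTwoElementary`,
`deltaInvariant = δ`, `a = ℓ = length`). The tree already identifies these lattices (`kummerForm`, `nikulinForm` and their
discriminant forms `≅ ±q_{U(2)³}`; `restrict_nikulinInvariant_equivalent : Λ^ι ≃ E₈(−2) ⊕ U³`,
`restrict_nikulinAntiInvariant_equivalent : (Λ^ι)^⊥ ≃ E₈(−2)`; `restrict_enriquesInvariant_equivalent :
Λ^ι ≃ (E₈(−1) ⊕ U)(2)`) and proves their ranks, lengths and (for `K`, `N`) signatures; this file adds that each is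
**2-elementary** and computes Nikulin's parity invariant **`δ`** (all `= 0`), assembling the triples `(r, a, δ)`.
Written for lane `lit-hodgefound` (Track 2 foundations; prover seat `lit-hodgefound-p18`, gen 30, row g30-#4).
THEOREMS ONLY — no definition, no named fact, no instance, no notation.

## Sources

* [AlexeevNikulin2006] V. Alexeev, V. V. Nikulin, *Del Pezzo and K3 surfaces*, MSJ Memoirs 15 (2006) =
  arXiv:math/0406536: §2.2 (p0019): "The triplet `(r, a, δ)` […] If `(r, a, δ) = (10, 10, 0)` then `X^θ = C = ∅`, i.e.
  in this case `Y` is an Enriques surface"; §9.1 eq. (9.5) (the 2-elementary forms `u_+^{(2)}(2)` on `U(2)`);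
  §9.2 ("`δ = 0`: then […] `q_M ≅ e₁ u_+^{(2)}(2) ⊕ e₂ v_+^{(2)}(2)`").
* [Huybrechts2016K3] D. Huybrechts, *Lectures on K3 surfaces*, Ch. 14 Prop. 3.14 (iv) ("`q_K ≃ q_{U(2)}^{⊕3}`"),
  Ch. 14 §0.3 (vii) ("`H²(X,ℤ)^ι ≃ (E₈(−1) ⊕ U)(2)`" for an Enriques quotient), Ch. 15 §4.1 (`H²(X,ℤ)^{⟨ι⟩} ≃
  E₈(−2) ⊕ U^{⊕3}`, `L ≃ E₈(−2)` for a Nikulin involution).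
* [VanGeemenSarti2007] B. van Geemen, A. Sarti, *Nikulin involutions on K3 surfaces*, Math. Z. 255 (2007), §1.3,
  §1.10 ("`(A_K, q_K) ≅ (A_N, −q_N)`", `K = U(2)³`).
* [GarbagnatiSarti2008] A. Garbagnati, A. Sarti, *Projective models of K3 surfaces with an even set*, Adv. Geom. 8
  (2008), Def. 3.1 and the remark after it ("This lattice is a negative definite lattice of discriminant `2⁶` and
  discriminant group `(ℤ/2ℤ)^{⊕6}`").

## Contents

* §1 `U(2)^{⊕3}` is 2-elementary with `δ = 0` (twist by `2` of the even unimodular `U^{⊕3}`); a lattice whose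
  discriminant group is `≃+ (ι → ℤ/2ℤ)` is 2-elementary.
* §2 **Kummer lattice: `K` is 2-elementary, `δ(K) = 0`, `(r, a, δ)(K) = (16, 6, 0)`, `σ = −16`.**
* §3 **Nikulin lattice: `N` is 2-elementary, `δ(N) = 0`, `(r, a, δ)(N) = (8, 6, 0)`, `σ = −8`.**
* §4 **Nikulin involution: `(Λ^ι)^⊥ ≅ E₈(−2)` has `(r, a, δ) = (8, 8, 0)`; `Λ^ι ≅ E₈(−2) ⊕ U³` has
  `(r, a, δ) = (14, 8, 0)`.**
* §5 **Enriques involution: `Λ^ι ≅ (E₈(−1) ⊕ U)(2)` has `(r, a, δ) = (10, 10, 0)` and `σ = −8`** — the triple which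
  [AlexeevNikulin2006, §2.2] attaches to "`Y` is an Enriques surface".
-/

noncomputable section

open Module Function Matrix
open LinearMap (BilinForm)
open LinearMap.BilinForm
open Literature.Topology.FourManifolds

namespace Literature.AlgebraicGeometry.Surfaces

/-! ### §1 Two transport helpers -/

/-- A lattice whose discriminant group is (additively) `(ℤ/2ℤ)^ι` is 2-elementary. [cite: AlexeevNikulin2006, §9.1.1 ("2-elementary … `𝔄 ≅ (ℤ/2ℤ)^a`")] -/
theorem isTwoElementary_of_addEquiv_zmod_two {P : Type*} [AddCommGroup P] {B : BilinForm ℤ P} {ι : Type*}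
    (e : B.discriminantGroup ≃+ (ι → ZMod 2)) : B.IsTwoElementary := fun a ↦ e.injective <| by
  rw [map_zsmul, map_zero]
  exact funext fun i ↦ by rw [Pi.smul_apply, Pi.zero_apply, zsmul_eq_mul]; exact mul_eq_zero_of_left rfl _

/-- **`U(2)^{⊕3}` is 2-elementary with `δ = 0`** (`q_{U(2)} = u_+^{(2)}(2)` takes values in `ℤ/2ℤ`).
[cite: AlexeevNikulin2006, §9.1 eq. (9.5)] [cite: Huybrechts2016K3, Ch. 14 Prop. 3.14 (iv)] -/
theorem isTwoElementary_deltaInvariant_two_smul_hyperbolicSum_three (h₁ : ((2 : ℤ) • hyperbolicSum 3).Nondegenerate)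
    (h₂ : ((2 : ℤ) • hyperbolicSum 3).IsSymm) (h₃ : ((2 : ℤ) • hyperbolicSum 3).IsEven) :
    ((2 : ℤ) • hyperbolicSum 3).IsTwoElementary ∧ ((2 : ℤ) • hyperbolicSum 3).deltaInvariant h₁ h₂ h₃ = 0 :=
  ⟨isTwoElementary_two_smul_of_isUnimodular _ (isUnimodular_hyperbolicSum 3),
    deltaInvariant_two_smul_eq_zero_of_isEven _ (isUnimodular_hyperbolicSum 3) (isEven_hyperbolicSum 3) h₁ h₂ h₃⟩

/-- The hypotheses of the previous theorem hold. [cite: Huybrechts2016K3, Ch. 14 Prop. 3.14 (iv)] -/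
theorem nondegenerate_isSymm_isEven_two_smul_hyperbolicSum_three :
    ((2 : ℤ) • hyperbolicSum 3).Nondegenerate ∧ ((2 : ℤ) • hyperbolicSum 3).IsSymm ∧ ((2 : ℤ) • hyperbolicSum 3).IsEven :=
  ⟨(nondegenerate_zsmul_iff _ two_ne_zero).2 (isUnimodular_hyperbolicSum 3).nondegenerate,
    isSymm_smul_of_isSymm _ 2 (isSymm_hyperbolicSum 3), fun x ↦ ⟨hyperbolicSum 3 x x, by rw [smul_apply_apply]; ring⟩⟩

/-! ### §2 The Kummer lattice `K`: `(r, a, δ) = (16, 6, 0)` -/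

/-- **`K` is 2-elementary** (`A_K ≅ A_{U(2)³} ≅ (ℤ/2ℤ)⁶`). [cite: Huybrechts2016K3, Ch. 14 Prop. 3.14 (iv) ("`A_K ≅ (ℤ/2ℤ)^{⊕6}` … `q_K ≃ q_{U(2)}^{⊕3}`")] -/
theorem isTwoElementary_kummerForm : IsTwoElementary kummerForm := by
  obtain ⟨h₁, h₂, h₃⟩ := nondegenerate_isSymm_isEven_two_smul_hyperbolicSum_three
  exact (isTwoElementary_iff_of_addEquiv kummerDiscriminantIso.toAddEquiv).1
    (isTwoElementary_deltaInvariant_two_smul_hyperbolicSum_three h₁ h₂ h₃).1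

/-- **`δ(K) = 0`**: `q_K ≅ q_{U(2)³}` is `ℤ/2ℤ`-valued. [cite: Huybrechts2016K3, Ch. 14 Prop. 3.14 (iv)] [cite: AlexeevNikulin2006, §9.2 ("`δ = 0` … `q_M ≅ e₁ u_+^{(2)}(2) ⊕ …`")] -/
theorem deltaInvariant_kummerForm :
    kummerForm.deltaInvariant nondegenerate_kummerForm isSymm_kummerForm isEven_kummerForm = 0 := by
  obtain ⟨h₁, h₂, h₃⟩ := nondegenerate_isSymm_isEven_two_smul_hyperbolicSum_three
  rw [← (isTwoElementary_deltaInvariant_two_smul_hyperbolicSum_three h₁ h₂ h₃).2]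
  exact deltaInvariant_eq_deltaInvariant_of_surjective h₁ h₂ h₃ nondegenerate_kummerForm isSymm_kummerForm
    isEven_kummerForm kummerDiscriminantIso kummerDiscriminantIso.surjective
    fun a ↦ Or.inl (discriminantQuad_kummerDiscriminantIso h₁ h₂ h₃ a)

/-- **`(r, a, δ)(K) = (16, 6, 0)`, `σ(K) = −16`**: the Kummer lattice is an even, negative definite, 2-elementary
lattice of rank `16` with `a = ℓ(K) = 6` and `δ = 0`. [cite: Huybrechts2016K3, Ch. 14 Prop. 3.14 (iv)] [cite: AlexeevNikulin2006, §2.2 (the invariants `(r, a, δ)`)] -/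
theorem kummerForm_rad_invariants :
    finrank ℤ kummerLattice = 16 ∧ kummerForm.IsTwoElementary ∧ kummerForm.length = 6 ∧
      kummerForm.deltaInvariant nondegenerate_kummerForm isSymm_kummerForm isEven_kummerForm = 0 ∧
        kummerForm.signature = -16 :=
  ⟨finrank_kummerLattice, isTwoElementary_kummerForm, length_kummerForm, deltaInvariant_kummerForm, signature_kummerForm⟩

/-! ### §3 The Nikulin lattice `N`: `(r, a, δ) = (8, 6, 0)` -/

/-- **`N` is 2-elementary** ("discriminant group `(ℤ/2ℤ)^{⊕6}`"; `A_N ≅ A_{U(2)³}`).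
[cite: GarbagnatiSarti2008, Def. 3.1 and the following remark] [cite: VanGeemenSarti2007, §1.10] -/
theorem isTwoElementary_nikulinForm : IsTwoElementary nikulinForm := by
  obtain ⟨h₁, h₂, h₃⟩ := nondegenerate_isSymm_isEven_two_smul_hyperbolicSum_three
  exact (isTwoElementary_iff_of_addEquiv nikulinDiscriminantIso.toAddEquiv).1
    (isTwoElementary_deltaInvariant_two_smul_hyperbolicSum_three h₁ h₂ h₃).1

/-- **`δ(N) = 0`**: `q_N ≅ −q_{U(2)³}` is `ℤ/2ℤ`-valued. [cite: VanGeemenSarti2007, §1.10 ("`(A_K, q_K) ≅ (A_N, −q_N)`")] [cite: AlexeevNikulin2006, §9.2] -/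
theorem deltaInvariant_nikulinForm :
    nikulinForm.deltaInvariant nondegenerate_nikulinForm isSymm_nikulinForm isEven_nikulinForm = 0 := by
  obtain ⟨h₁, h₂, h₃⟩ := nondegenerate_isSymm_isEven_two_smul_hyperbolicSum_three
  rw [← (isTwoElementary_deltaInvariant_two_smul_hyperbolicSum_three h₁ h₂ h₃).2]
  exact deltaInvariant_eq_deltaInvariant_of_surjective h₁ h₂ h₃ nondegenerate_nikulinForm isSymm_nikulinForm
    isEven_nikulinForm nikulinDiscriminantIso nikulinDiscriminantIso.surjective
    fun a ↦ Or.inr (discriminantQuad_nikulinDiscriminantIso_eq_neg h₁ h₂ h₃ a)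

/-- **`(r, a, δ)(N) = (8, 6, 0)`, `σ(N) = −8`**: the Nikulin lattice is an even, negative definite, 2-elementary
lattice of rank `8` with `a = ℓ(N) = 6` and `δ = 0`. [cite: GarbagnatiSarti2008, Def. 3.1] [cite: VanGeemenSarti2007, §1.10] [cite: AlexeevNikulin2006, §2.2] -/
theorem nikulinForm_rad_invariants :
    finrank ℤ nikulinLattice = 8 ∧ nikulinForm.IsTwoElementary ∧ nikulinForm.length = 6 ∧
      nikulinForm.deltaInvariant nondegenerate_nikulinForm isSymm_nikulinForm isEven_nikulinForm = 0 ∧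
        nikulinForm.signature = -8 :=
  ⟨finrank_nikulinLattice, isTwoElementary_nikulinForm, length_nikulinForm, deltaInvariant_nikulinForm,
    signature_nikulinForm⟩

/-! ### §4 Nikulin involutions: `(Λ^ι)^⊥ ≅ E₈(−2)` is `(8, 8, 0)`, `Λ^ι ≅ E₈(−2) ⊕ U³` is `(14, 8, 0)` -/

/-- `E₈(−2) = (−2) • e8Form` is 2-elementary with `δ = 0` and `σ = −8` (the twist by `2` of the even unimodular
`E₈(−1)`). [cite: VanGeemenSarti2007, §2 (proof of Prop. 2.2) ("`A_E ≅ (1/2)E₈(−2)/E₈(−2) ≅ (ℤ/2ℤ)⁸`")] [cite: AlexeevNikulin2006, §9.2] -/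
theorem isTwoElementary_deltaInvariant_signature_neg_two_smul_e8Form (h₁ : ((-2 : ℤ) • e8Form).Nondegenerate)
    (h₂ : ((-2 : ℤ) • e8Form).IsSymm) (h₃ : ((-2 : ℤ) • e8Form).IsEven) :
    ((-2 : ℤ) • e8Form).IsTwoElementary ∧ ((-2 : ℤ) • e8Form).deltaInvariant h₁ h₂ h₃ = 0 ∧
      ((-2 : ℤ) • e8Form).signature = -8 := by
  have heq : (-2 : ℤ) • e8Form = (2 : ℤ) • (-e8Form) := by rw [smul_neg, ← neg_smul]
  have key : ∀ (C : BilinForm ℤ (Fin 8 → ℤ)) (_ : C = (2 : ℤ) • (-e8Form)) (h₁ : C.Nondegenerate) (h₂ : C.IsSymm)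
      (h₃ : C.IsEven), C.IsTwoElementary ∧ C.deltaInvariant h₁ h₂ h₃ = 0 ∧ C.signature = -8 := by
    rintro C rfl h₁ h₂ h₃
    exact ⟨isTwoElementary_two_smul_neg_e8Form, deltaInvariant_two_smul_neg_e8Form h₁ h₂ h₃,
      signature_two_smul_neg_e8Form⟩
  exact key _ heq h₁ h₂ h₃

/-- **The anti-invariant lattice `(Λ^ι)^⊥ ≅ E₈(−2)` of a Nikulin involution is 2-elementary with `δ = 0`;
with the tree's `finrank_nikulinAntiInvariant = 8`, `length_restrict_nikulinAntiInvariant = 8`: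
`(r, a, δ) = (8, 8, 0)`.** [cite: VanGeemenSarti2007, §1.3, §2 (proof of Prop. 2.2)] [cite: Huybrechts2016K3, Ch. 15 §4.1] [cite: AlexeevNikulin2006, §2.2] -/
theorem nikulinAntiInvariant_rad_invariants (h₁ : ((Matrix.toBilin' k3Gram).restrict nikulinAntiInvariant).Nondegenerate)
    (h₂ : ((Matrix.toBilin' k3Gram).restrict nikulinAntiInvariant).IsSymm)
    (h₃ : ((Matrix.toBilin' k3Gram).restrict nikulinAntiInvariant).IsEven) :
    finrank ℤ nikulinAntiInvariant = 8 ∧ ((Matrix.toBilin' k3Gram).restrict nikulinAntiInvariant).IsTwoElementary ∧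
      ((Matrix.toBilin' k3Gram).restrict nikulinAntiInvariant).length = 8 ∧
        ((Matrix.toBilin' k3Gram).restrict nikulinAntiInvariant).deltaInvariant h₁ h₂ h₃ = 0 ∧
          ((Matrix.toBilin' k3Gram).restrict nikulinAntiInvariant).signature = -8 := by
  have hE := restrict_nikulinAntiInvariant_equivalent
  have hu : BilinForm.IsUnimodular e8Form := isUnimodular_e8Form_holds
  have h₁' : ((-2 : ℤ) • e8Form).Nondegenerate := (nondegenerate_zsmul_iff _ (by norm_num)).2 hu.nondegenerate
  have h₂' : ((-2 : ℤ) • e8Form).IsSymm := isSymm_smul_of_isSymm _ (-2) isSymm_e8Form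
  have h₃' : ((-2 : ℤ) • e8Form).IsEven := fun x ↦ ⟨-e8Form x x, by rw [smul_apply_apply]; ring⟩
  obtain ⟨h2, hδ, hσ⟩ := isTwoElementary_deltaInvariant_signature_neg_two_smul_e8Form h₁' h₂' h₃'
  refine ⟨finrank_nikulinAntiInvariant, (isTwoElementary_iff_of_equivalent hE).2 h2, length_restrict_nikulinAntiInvariant,
    ?_, (signature_eq_of_equivalent hE).trans hσ⟩
  rw [← hδ]
  exact (deltaInvariant_eq_of_equivalent hE h₁ h₂ h₃ h₁' h₂' h₃').symm

/-- **The invariant lattice `Λ^ι ≅ E₈(−2) ⊕ U^{⊕3}` of a Nikulin involution is 2-elementary with `δ = 0` and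
`σ = −8`; with the tree's `finrank_nikulinInvariant = 14`, `length_restrict_nikulinInvariant = 8`:
`(r, a, δ) = (14, 8, 0)`.** [cite: VanGeemenSarti2007, §1.3 ("`H²(X,ℤ)^ι ≅ U³ ⊕ E₈(−2)`")] [cite: Huybrechts2016K3, Ch. 15 §4.1] [cite: AlexeevNikulin2006, §2.2] -/
theorem nikulinInvariant_rad_invariants (h₁ : ((Matrix.toBilin' k3Gram).restrict nikulinInvariant).Nondegenerate)
    (h₂ : ((Matrix.toBilin' k3Gram).restrict nikulinInvariant).IsSymm)
    (h₃ : ((Matrix.toBilin' k3Gram).restrict nikulinInvariant).IsEven) :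
    finrank ℤ nikulinInvariant = 14 ∧ ((Matrix.toBilin' k3Gram).restrict nikulinInvariant).IsTwoElementary ∧
      ((Matrix.toBilin' k3Gram).restrict nikulinInvariant).length = 8 ∧
        ((Matrix.toBilin' k3Gram).restrict nikulinInvariant).deltaInvariant h₁ h₂ h₃ = 0 ∧
          ((Matrix.toBilin' k3Gram).restrict nikulinInvariant).signature = -8 := by
  have hE := restrict_nikulinInvariant_equivalent
  have hu : BilinForm.IsUnimodular e8Form := isUnimodular_e8Form_holds
  have h₁' : ((-2 : ℤ) • e8Form).Nondegenerate := (nondegenerate_zsmul_iff _ (by norm_num)).2 hu.nondegenerate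
  have h₂' : ((-2 : ℤ) • e8Form).IsSymm := isSymm_smul_of_isSymm _ (-2) isSymm_e8Form
  have h₃' : ((-2 : ℤ) • e8Form).IsEven := fun x ↦ ⟨-e8Form x x, by rw [smul_apply_apply]; ring⟩
  obtain ⟨h2, hδ, hσ⟩ := isTwoElementary_deltaInvariant_signature_neg_two_smul_e8Form h₁' h₂' h₃'
  -- `U³ = U ⊕ (U ⊕ U)` is even unimodular of signature `0`
  have hU : (hyperbolicForm.prod (hyperbolicForm.prod hyperbolicForm)).IsUnimodular :=
    isUnimodular_prod_iff.2 ⟨isUnimodular_hyperbolicForm_holds,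
      isUnimodular_prod_iff.2 ⟨isUnimodular_hyperbolicForm_holds, isUnimodular_hyperbolicForm_holds⟩⟩
  have hUs : (hyperbolicForm.prod (hyperbolicForm.prod hyperbolicForm)).IsSymm :=
    isSymm_hyperbolicForm.prod (isSymm_hyperbolicForm.prod isSymm_hyperbolicForm)
  have hUe : (hyperbolicForm.prod (hyperbolicForm.prod hyperbolicForm)).IsEven :=
    isEven_prod_iff.2 ⟨isEven_hyperbolicForm, isEven_prod_iff.2 ⟨isEven_hyperbolicForm, isEven_hyperbolicForm⟩⟩
  have hUσ : (hyperbolicForm.prod (hyperbolicForm.prod hyperbolicForm)).signature = 0 := by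
    rw [signature_prod _ _ isSymm_hyperbolicForm (isSymm_hyperbolicForm.prod isSymm_hyperbolicForm),
      signature_prod _ _ isSymm_hyperbolicForm isSymm_hyperbolicForm, signature_hyperbolicForm_holds, add_zero, add_zero]
  -- the model `E₈(−2) ⊕ U³`
  have hM2 : (((-2 : ℤ) • e8Form).prod (hyperbolicForm.prod (hyperbolicForm.prod hyperbolicForm))).IsTwoElementary :=
    (isTwoElementary_prod_iff _ _).2 ⟨h2, IsTwoElementary.of_isUnimodular _ hU⟩
  have hMδ : (((-2 : ℤ) • e8Form).prod (hyperbolicForm.prod (hyperbolicForm.prod hyperbolicForm))).deltaInvariant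
      (h₁'.prod hU.nondegenerate) (h₂'.prod hUs) (isEven_prod_iff.2 ⟨h₃', hUe⟩) = 0 := by
    have hd := deltaInvariant_prod _ _ h₁' h₂' h₃' hU.nondegenerate hUs hUe
    rw [hδ, deltaInvariant_eq_zero_of_isUnimodular _ hU.nondegenerate hUs hUe hU, max_self] at hd
    exact hd
  have hMσ : (((-2 : ℤ) • e8Form).prod (hyperbolicForm.prod (hyperbolicForm.prod hyperbolicForm))).signature = -8 := by
    rw [signature_prod _ _ h₂' hUs, hσ, hUσ, add_zero]
  refine ⟨finrank_nikulinInvariant, (isTwoElementary_iff_of_equivalent hE).2 hM2, length_restrict_nikulinInvariant, ?_,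
    (signature_eq_of_equivalent hE).trans hMσ⟩
  rw [← hMδ]
  exact (deltaInvariant_eq_of_equivalent hE h₁ h₂ h₃ _ _ _).symm

/-! ### §5 Enriques involutions: `Λ^ι ≅ (E₈(−1) ⊕ U)(2) = E₈(−2) ⊕ U(2)` is `(10, 10, 0)` -/

/-- **Alexeev–Nikulin §2.2: "If `(r, a, δ) = (10, 10, 0)` then `X^θ = ∅`, i.e. `Y` is an Enriques surface"** — the
lattice side: the invariant lattice `Λ^ι ≅ (E₈(−1) ⊕ U)(2)` of the Enriques involution is 2-elementary with
`δ = 0` and `σ = −8`; with the tree's `finrank_enriquesInvariant = 10`, `length_restrict_enriquesInvariant = 10`: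
**`(r, a, δ)(Λ^ι) = (10, 10, 0)`**. [cite: AlexeevNikulin2006, §2.2 (p0019)] [cite: Huybrechts2016K3, Ch. 14 §0.3 (vii)] -/
theorem enriquesInvariant_rad_invariants (h₁ : (k3Model.restrict enriquesInvariant).Nondegenerate)
    (h₂ : (k3Model.restrict enriquesInvariant).IsSymm) (h₃ : (k3Model.restrict enriquesInvariant).IsEven) :
    finrank ℤ enriquesInvariant = 10 ∧ (k3Model.restrict enriquesInvariant).IsTwoElementary ∧
      (k3Model.restrict enriquesInvariant).length = 10 ∧
        (k3Model.restrict enriquesInvariant).deltaInvariant h₁ h₂ h₃ = 0 ∧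
          (k3Model.restrict enriquesInvariant).signature = -8 := by
  have hE := restrict_enriquesInvariant_equivalent
  obtain ⟨hs, he, hu, hσ⟩ := pi_neg_e8Form_prod_hyperbolicSum_invariants 1 1
  have h₁' : ((2 : ℤ) • ((pi fun _ : Fin 1 ↦ -e8Form).prod (hyperbolicSum 1))).Nondegenerate :=
    (nondegenerate_zsmul_iff _ two_ne_zero).2 hu.nondegenerate
  have h₂' : ((2 : ℤ) • ((pi fun _ : Fin 1 ↦ -e8Form).prod (hyperbolicSum 1))).IsSymm := isSymm_smul_of_isSymm _ 2 hs
  have h₃' : ((2 : ℤ) • ((pi fun _ : Fin 1 ↦ -e8Form).prod (hyperbolicSum 1))).IsEven := fun x ↦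
    ⟨((pi fun _ : Fin 1 ↦ -e8Form).prod (hyperbolicSum 1)) x x, by rw [smul_apply_apply]; ring⟩
  refine ⟨finrank_enriquesInvariant, (isTwoElementary_iff_of_equivalent hE).2 (isTwoElementary_two_smul_of_isUnimodular _ hu),
    length_restrict_enriquesInvariant, ?_, ?_⟩
  · rw [← deltaInvariant_two_smul_eq_zero_of_isEven _ hu he h₁' h₂' h₃']
    exact (deltaInvariant_eq_of_equivalent hE h₁ h₂ h₃ h₁' h₂' h₃').symm
  · rw [signature_eq_of_equivalent hE, signature_smul_of_pos _ two_pos, hσ]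
    norm_num

end Literature.AlgebraicGeometry.Surfaces
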